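import Mathlib
import Literature.Analysis.FluidPDE.PoincareBall

/-!
# Route PlaneEnergyCeiling · crux `PlanarEnergyLiouville` — oscillation of a `C¹` map with
# bounded gradient and small Dirichlet energy on a ball

Helper file (Mathlib + `PoincareBall`) for the registered stub `stub_lateQuietTimes` (S2) of the
line `Lines/mean_dissipation_sieve.lean` of the crux item stmt-NavierStokesRegularity-16856
(`Theses.PlaneEnergyCeiling.PlanarEnergyLiouville`); landed `--supports` that item.
Main result `norm_sub_average_le_of_energy`: for `f ∈ C¹(ℝ³; F)` with `‖Df‖ ≤ G` and
`∫_{B(x₀,2R)} ‖Df‖² ≤ ε`, every `x ∈ B(x₀, R)` has `‖f(x) − ⨍_{B(x₀,2R)} f‖ ≤ 3Gρ₀ + 2√(ε/ρ₀)`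
for each `0 < ρ₀ ≤ R` — a bound that does NOT grow with `R` (the point of S2: quiet dissipation
on a large ball forces `L^∞`-flatness). Proof: Jensen, the segment representation, Tonelli in
`(y, τ)`, the gradient bound for `τ ≤ ρ₀/R`, and for `τ ≥ ρ₀/R` the substitution
`z = x + τ(y − x)` onto the ball `B(x + τ(x₀ − x), 2τR) ⊆ B(x₀, 2R)` (Jacobian `τ³`) with
Cauchy–Schwarz, then `∫_{τ₀}^1 τ^{-3/2} dτ ≤ 2τ₀^{-1/2}` (registered helper sub-goal
`integral_inv_mul_sqrt_le`). Elementary real analysis; no fluid mechanics.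
-/

noncomputable section

set_option linter.dupNamespace false -- nested layout Summit.<S>.<Sub>, Sub = S (D-0017)

open MeasureTheory Set Filter Metric Function Real
open _root_.Topology
open scoped ENNReal NNReal
namespace Summit.NavierStokesRegularity.NavierStokesRegularity.Theorems.PlaneEnergyCeilingPlanarEnergyLiouville
open Literature.Analysis.FluidPDE.PoincareBall (lintegral_comp_smul_add sq_lintegral_le_measure_mul_lintegral_sq)
variable {F : Type*} [NormedAddCommGroup F] [NormedSpace ℝ F] [CompleteSpace F]

/-- **Segment FTC bound**: `‖f(b) − f(a)‖ₑ ≤ ‖b − a‖ₑ ∫₀¹ ‖Df(a + τ(b − a))‖ₑ dτ` for `f ∈ C¹`.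
[folklore] -/
theorem enorm_sub_le_mul_lintegral_segment {f : EuclideanSpace ℝ (Fin 3) → F}
    (hf : ContDiff ℝ 1 f) (a b : EuclideanSpace ℝ (Fin 3)) :
    ‖f b - f a‖ₑ ≤ ‖b - a‖ₑ * ∫⁻ τ in Icc (0 : ℝ) 1, ‖fderiv ℝ f (a + τ • (b - a))‖ₑ := by
  have hcont : Continuous fun s : ℝ => fderiv ℝ f (a + s • (b - a)) (b - a) :=
    ((hf.continuous_fderiv one_ne_zero).comp (by fun_prop)).clm_apply continuous_const
  have hftc := intervalIntegral.integral_eq_sub_of_hasDerivAt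
    (fun τ _ => Literature.Analysis.FluidPDE.PoincareBall.hasDerivAt_comp_segment hf a b τ)
    (hcont.intervalIntegrable 0 1)
  simp only [zero_smul, add_zero, one_smul, add_sub_cancel] at hftc
  rw [← hftc, intervalIntegral.integral_of_le zero_le_one]
  calc ‖∫ s in Ioc (0 : ℝ) 1, fderiv ℝ f (a + s • (b - a)) (b - a)‖ₑ
      ≤ ∫⁻ s in Ioc (0 : ℝ) 1, ‖fderiv ℝ f (a + s • (b - a)) (b - a)‖ₑ :=
        enorm_integral_le_lintegral_enorm _
    _ ≤ ∫⁻ s in Icc (0 : ℝ) 1, ‖fderiv ℝ f (a + s • (b - a)) (b - a)‖ₑ :=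
        lintegral_mono_set Ioc_subset_Icc_self
    _ ≤ ∫⁻ s in Icc (0 : ℝ) 1, ‖fderiv ℝ f (a + s • (b - a))‖ₑ * ‖b - a‖ₑ :=
        lintegral_mono fun s => ContinuousLinearMap.le_opENorm _ _
    _ = ‖b - a‖ₑ * ∫⁻ s in Icc (0 : ℝ) 1, ‖fderiv ℝ f (a + s • (b - a))‖ₑ := by
        rw [lintegral_mul_const' _ _ enorm_ne_top, mul_comm]

/-- **Substitution towards a point, shrinking the ball.** For `τ > 0` the map `y ↦ x + τ(y − x)`
sends `B(x₀, r)` into `B(x + τ(x₀ − x), τ r)` with Jacobian `τ³`, so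
`∫_{B(x₀,r)} h(x + τ(y − x)) dy ≤ τ⁻³ ∫_{B(x + τ(x₀ − x), τr)} h`. [folklore] -/
theorem setLIntegral_comp_segment_le_shrink (h : EuclideanSpace ℝ (Fin 3) → ℝ≥0∞)
    (x₀ x : EuclideanSpace ℝ (Fin 3)) (r : ℝ) {τ : ℝ} (hτ : 0 < τ) :
    ∫⁻ y in ball x₀ r, h (x + τ • (y - x)) ≤
      ENNReal.ofReal (τ ^ 3)⁻¹ * ∫⁻ z in ball (x + τ • (x₀ - x)) (τ * r), h z := by
  set S := ball x₀ r with hS_def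
  set S' := ball (x + τ • (x₀ - x)) (τ * r) with hS'_def
  rw [← lintegral_indicator measurableSet_ball, ← lintegral_indicator (measurableSet_ball (x := _))]
  have hpt : ∀ y, S.indicator (fun y => h (x + τ • (y - x))) y ≤
      (S'.indicator h) (τ • y + (1 - τ) • x) := by
    intro y
    by_cases hy : y ∈ S
    · rw [indicator_of_mem hy]
      have hmem : τ • y + (1 - τ) • x ∈ S' := by
        rw [hS'_def, mem_ball, dist_eq_norm]
        have : τ • y + (1 - τ) • x - (x + τ • (x₀ - x)) = τ • (y - x₀) := by module
        rw [this, norm_smul, Real.norm_eq_abs, abs_of_pos hτ]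
        exact mul_lt_mul_of_pos_left (mem_ball_iff_norm.1 hy) hτ
      rw [indicator_of_mem hmem]
      have : x + τ • (y - x) = τ • y + (1 - τ) • x := by module
      rw [this]
    · rw [indicator_of_notMem hy]
      exact bot_le
  have hdim : Module.finrank ℝ (EuclideanSpace ℝ (Fin 3)) = 3 := finrank_euclideanSpace_fin
  calc ∫⁻ y, S.indicator (fun y => h (x + τ • (y - x))) y
      ≤ ∫⁻ y, (S'.indicator h) (τ • y + (1 - τ) • x) := lintegral_mono hpt
    _ = ENNReal.ofReal |(τ ^ Module.finrank ℝ (EuclideanSpace ℝ (Fin 3)))⁻¹| *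
          ∫⁻ z, S'.indicator h z := lintegral_comp_smul_add _ hτ.ne' _
    _ = ENNReal.ofReal (τ ^ 3)⁻¹ * ∫⁻ z, S'.indicator h z := by
        rw [hdim, abs_of_pos (by positivity)]

/-- **The energy bound on the shrunken ball.** If `∫_{B(x₀,2R)} ‖Df‖² ≤ ε` and `x ∈ B(x₀, R)`, then
for `0 < τ ≤ 1`: `∫_{B(x₀,2R)} ‖Df(x + τ(y − x))‖ dy ≤ (τ³)⁻¹ √(τ³ V ε)` with
`V = |B(x₀, 2R)| = (2R)³ · 4π/3` (substitution + Cauchy–Schwarz on the image ball, which lies in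
`B(x₀, 2R)`). [folklore] -/
theorem setLIntegral_enorm_fderiv_segment_le {f : EuclideanSpace ℝ (Fin 3) → F}
    {x₀ x : EuclideanSpace ℝ (Fin 3)} {R ε : ℝ} (hR : 0 < R) (hx : x ∈ ball x₀ R) (hε : 0 ≤ ε)
    (hD : ∫⁻ z in ball x₀ (2 * R), ‖fderiv ℝ f z‖ₑ ^ 2 ≤ ENNReal.ofReal ε) {τ : ℝ}
    (hτ0 : 0 < τ) (hτ1 : τ ≤ 1) :
    ∫⁻ y in ball x₀ (2 * R), ‖fderiv ℝ f (x + τ • (y - x))‖ₑ ≤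
      ENNReal.ofReal ((τ ^ 3)⁻¹ * Real.sqrt (τ ^ 3 * ((2 * R) ^ 3 * (π * 4 / 3)) * ε)) := by
  set c : EuclideanSpace ℝ (Fin 3) := x + τ • (x₀ - x) with hc_def
  set ρ : ℝ := τ * (2 * R) with hρ_def
  have hsub : ball c ρ ⊆ ball x₀ (2 * R) := by
    intro z hz
    rw [mem_ball, dist_eq_norm] at hz ⊢
    have hxx : ‖x - x₀‖ < R := mem_ball_iff_norm.1 hx
    calc ‖z - x₀‖ = ‖(z - c) + (1 - τ) • (x - x₀)‖ := by rw [hc_def]; congr 1; module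
      _ ≤ ‖z - c‖ + ‖(1 - τ) • (x - x₀)‖ := norm_add_le _ _
      _ = ‖z - c‖ + (1 - τ) * ‖x - x₀‖ := by
          rw [norm_smul, Real.norm_eq_abs, abs_of_nonneg (by linarith)]
      _ < τ * (2 * R) + (1 - τ) * ‖x - x₀‖ := by rw [hρ_def] at hz; linarith
      _ ≤ τ * (2 * R) + (1 - τ) * R := by nlinarith
      _ ≤ 2 * R := by nlinarith
  have hvol : volume (ball c ρ) = ENNReal.ofReal (τ ^ 3 * ((2 * R) ^ 3 * (π * 4 / 3))) := by
    rw [EuclideanSpace.volume_ball_fin_three, hρ_def, ← ENNReal.ofReal_pow (by positivity),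
      ← ENNReal.ofReal_mul (by positivity)]
    congr 1
    ring
  -- Cauchy–Schwarz on the image ball
  have hg : AEMeasurable (fun z => ‖fderiv ℝ f z‖ₑ) (volume.restrict (ball c ρ)) :=
    (measurable_fderiv ℝ f).enorm.aemeasurable
  have hcs := sq_lintegral_le_measure_mul_lintegral_sq (volume.restrict (ball c ρ)) hg
  rw [Measure.restrict_apply_univ, hvol] at hcs
  have hsq : (∫⁻ z in ball c ρ, ‖fderiv ℝ f z‖ₑ) ^ 2 ≤
      ENNReal.ofReal (τ ^ 3 * ((2 * R) ^ 3 * (π * 4 / 3)) * ε) := by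
    calc (∫⁻ z in ball c ρ, ‖fderiv ℝ f z‖ₑ) ^ 2
        ≤ ENNReal.ofReal (τ ^ 3 * ((2 * R) ^ 3 * (π * 4 / 3))) *
            ∫⁻ z in ball c ρ, ‖fderiv ℝ f z‖ₑ ^ 2 := hcs
      _ ≤ ENNReal.ofReal (τ ^ 3 * ((2 * R) ^ 3 * (π * 4 / 3))) * ENNReal.ofReal ε := by
          gcongr
          exact (lintegral_mono_set hsub).trans hD
      _ = _ := by rw [← ENNReal.ofReal_mul (by positivity)]
  -- `X² ≤ ofReal a ⇒ X ≤ ofReal √a` (as in `PeriodicCylinder.le_ofReal_sqrt_of_sq_le`)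
  have h1 : ∫⁻ z in ball c ρ, ‖fderiv ℝ f z‖ₑ ≤
      ENNReal.ofReal (Real.sqrt (τ ^ 3 * ((2 * R) ^ 3 * (π * 4 / 3)) * ε)) := by
    rw [← ENNReal.pow_le_pow_left_iff two_ne_zero, ← ENNReal.ofReal_pow (Real.sqrt_nonneg _),
      Real.sq_sqrt (by positivity)]
    exact hsq
  calc ∫⁻ y in ball x₀ (2 * R), ‖fderiv ℝ f (x + τ • (y - x))‖ₑ
      ≤ ENNReal.ofReal (τ ^ 3)⁻¹ * ∫⁻ z in ball c ρ, ‖fderiv ℝ f z‖ₑ :=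
        setLIntegral_comp_segment_le_shrink _ x₀ x (2 * R) hτ0
    _ ≤ ENNReal.ofReal (τ ^ 3)⁻¹ *
          ENNReal.ofReal (Real.sqrt (τ ^ 3 * ((2 * R) ^ 3 * (π * 4 / 3)) * ε)) := by gcongr
    _ = _ := by rw [← ENNReal.ofReal_mul (by positivity)]

/-- The antiderivative of `τ ↦ (τ√τ)⁻¹` is `τ ↦ −2(√τ)⁻¹` on `τ > 0`. [folklore] -/
theorem hasDerivAt_neg_two_mul_inv_sqrt {τ : ℝ} (hτ : 0 < τ) :
    HasDerivAt (fun s : ℝ => -2 * (Real.sqrt s)⁻¹) ((τ * Real.sqrt τ)⁻¹) τ := by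
  have hs : Real.sqrt τ ≠ 0 := (Real.sqrt_pos.2 hτ).ne'
  have h1 : HasDerivAt (fun s : ℝ => (Real.sqrt s)⁻¹)
      (-(1 / (2 * Real.sqrt τ)) / (Real.sqrt τ) ^ 2) τ :=
    (Real.hasDerivAt_sqrt hτ.ne').inv hs
  have h2 := h1.const_mul (-2)
  refine h2.congr_deriv ?_
  have hsq : Real.sqrt τ ^ 2 = τ := Real.sq_sqrt hτ.le
  rw [hsq]
  field_simp

/-- `∫_{τ₀}^{1} (τ√τ)⁻¹ dτ ≤ 2 (√τ₀)⁻¹` for `0 < τ₀ ≤ 1` (registered helper sub-goal of the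
crux item, proved here). [folklore] -/
theorem integral_inv_mul_sqrt_le :
    ∀ {τ₀ : ℝ}, 0 < τ₀ → τ₀ ≤ 1 → ∫ τ in τ₀..1, (τ * Real.sqrt τ)⁻¹ ≤ 2 * (Real.sqrt τ₀)⁻¹ := by
  intro τ₀ hτ₀ hτ₁
  have hderiv : ∀ τ ∈ uIcc τ₀ 1,
      HasDerivAt (fun s : ℝ => -2 * (Real.sqrt s)⁻¹) ((τ * Real.sqrt τ)⁻¹) τ := by
    intro τ hτ
    rw [uIcc_of_le hτ₁] at hτ
    exact hasDerivAt_neg_two_mul_inv_sqrt (hτ₀.trans_le hτ.1)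
  have hcont : ContinuousOn (fun τ : ℝ => (τ * Real.sqrt τ)⁻¹) (uIcc τ₀ 1) := by
    rw [uIcc_of_le hτ₁]
    refine ContinuousOn.inv₀ (by fun_prop) ?_
    intro τ hτ
    have hτp : 0 < τ := hτ₀.trans_le hτ.1
    exact (mul_pos hτp (Real.sqrt_pos.2 hτp)).ne'
  rw [intervalIntegral.integral_eq_sub_of_hasDerivAt hderiv (hcont.intervalIntegrable)]
  have h1 : Real.sqrt 1 = 1 := Real.sqrt_one
  simp only [h1, inv_one, mul_one]
  have : 0 ≤ (Real.sqrt τ₀)⁻¹ := inv_nonneg.2 (Real.sqrt_nonneg _)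
  linarith

/-- **The `τ`-integral of the segment averages.** For `0 < τ₀ ≤ 1`, `|Df| ≤ G` and the energy
bound: `∫₀¹ ∫_{B(x₀,2R)} ‖Df(x + τ(y − x))‖ dy dτ ≤ τ₀ G V + √(Vε) · 2(√τ₀)⁻¹`, `V = |B(x₀,2R)|`
(the part `τ ≤ τ₀` by the gradient bound, the part `τ ≥ τ₀` by
`setLIntegral_enorm_fderiv_segment_le` and `∫_{τ₀}^1 τ^{-3/2} ≤ 2τ₀^{-1/2}`). [folklore] -/
theorem lintegral_lintegral_fderiv_segment_le {f : EuclideanSpace ℝ (Fin 3) → F}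
    {x₀ x : EuclideanSpace ℝ (Fin 3)} {R ε G τ₀ : ℝ} (hR : 0 < R)
    (hx : x ∈ ball x₀ R) (hε : 0 ≤ ε) (hG0 : 0 ≤ G)
    (hG : ∀ z, ‖fderiv ℝ f z‖ ≤ G)
    (hD : ∫⁻ z in ball x₀ (2 * R), ‖fderiv ℝ f z‖ₑ ^ 2 ≤ ENNReal.ofReal ε)
    (hτ₀ : 0 < τ₀) (hτ₁ : τ₀ ≤ 1) :
    ∫⁻ τ in Icc (0 : ℝ) 1, ∫⁻ y in ball x₀ (2 * R), ‖fderiv ℝ f (x + τ • (y - x))‖ₑ ≤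
      ENNReal.ofReal (τ₀ * (G * ((2 * R) ^ 3 * (π * 4 / 3)))) +
        ENNReal.ofReal (Real.sqrt (((2 * R) ^ 3 * (π * 4 / 3)) * ε) * (2 * (Real.sqrt τ₀)⁻¹)) := by
  set V : ℝ := (2 * R) ^ 3 * (π * 4 / 3) with hV_def
  have hV0 : 0 < V := by positivity
  have hvol : volume (ball x₀ (2 * R)) = ENNReal.ofReal V := by
    rw [EuclideanSpace.volume_ball_fin_three, hV_def, ← ENNReal.ofReal_pow (by positivity),
      ← ENNReal.ofReal_mul (by positivity)]
  set J : ℝ → ℝ≥0∞ := fun τ => ∫⁻ y in ball x₀ (2 * R), ‖fderiv ℝ f (x + τ • (y - x))‖ₑ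
    with hJ_def
  -- the crude bound from `|Df| ≤ G`
  have hJ1 : ∀ τ, J τ ≤ ENNReal.ofReal (G * V) := by
    intro τ
    calc J τ ≤ ∫⁻ y in ball x₀ (2 * R), ENNReal.ofReal G := by
          refine lintegral_mono fun y => ?_
          rw [← ofReal_norm]
          exact ENNReal.ofReal_le_ofReal (hG _)
      _ = ENNReal.ofReal G * volume (ball x₀ (2 * R)) := setLIntegral_const _ _
      _ = ENNReal.ofReal (G * V) := by rw [hvol, ← ENNReal.ofReal_mul hG0]
  -- the energy bound for `τ ≥ τ₀`
  have hJ2 : ∀ τ ∈ Icc τ₀ 1, J τ ≤ ENNReal.ofReal (Real.sqrt (V * ε) * (τ * Real.sqrt τ)⁻¹) := by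
    intro τ hτ
    have hτp : 0 < τ := hτ₀.trans_le hτ.1
    have h1 := setLIntegral_enorm_fderiv_segment_le (f := f) hR hx hε hD hτp hτ.2
    refine h1.trans (le_of_eq ?_)
    congr 1
    have hsq3 : Real.sqrt (τ ^ 3) = τ * Real.sqrt τ := by
      rw [show τ ^ 3 = τ ^ 2 * τ by ring, Real.sqrt_mul (by positivity), Real.sqrt_sq hτp.le]
    rw [show τ ^ 3 * ((2 * R) ^ 3 * (π * 4 / 3)) * ε = τ ^ 3 * (V * ε) by rw [hV_def]; ring,
      Real.sqrt_mul (by positivity), hsq3]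
    have hs : Real.sqrt τ ≠ 0 := (Real.sqrt_pos.2 hτp).ne'
    field_simp
    rw [Real.sq_sqrt hτp.le]
  -- split the `τ`-integral at `τ₀`
  have hsplit : Icc (0 : ℝ) 1 = Icc 0 τ₀ ∪ Icc τ₀ 1 := (Icc_union_Icc_eq_Icc hτ₀.le hτ₁).symm
  calc ∫⁻ τ in Icc (0 : ℝ) 1, J τ
      ≤ (∫⁻ τ in Icc (0 : ℝ) τ₀, J τ) + ∫⁻ τ in Icc τ₀ 1, J τ := by
        rw [hsplit]; exact lintegral_union_le _ _ _
    _ ≤ (∫⁻ τ in Icc (0 : ℝ) τ₀, ENNReal.ofReal (G * V)) +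
          ∫⁻ τ in Icc τ₀ 1, ENNReal.ofReal (Real.sqrt (V * ε) * (τ * Real.sqrt τ)⁻¹) :=
        add_le_add (lintegral_mono fun τ => hJ1 τ) (setLIntegral_mono' measurableSet_Icc hJ2)
    _ = ENNReal.ofReal (τ₀ * (G * V)) +
          ENNReal.ofReal (∫ τ in Icc τ₀ 1, Real.sqrt (V * ε) * (τ * Real.sqrt τ)⁻¹) := by
        congr 1
        · rw [setLIntegral_const, Real.volume_Icc, sub_zero, mul_comm,
            ← ENNReal.ofReal_mul hτ₀.le]
        · have hcont : ContinuousOn (fun τ : ℝ => Real.sqrt (V * ε) * (τ * Real.sqrt τ)⁻¹)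
              (Icc τ₀ 1) := by
            refine continuousOn_const.mul (ContinuousOn.inv₀ (by fun_prop) ?_)
            intro τ hτ
            have hτp : 0 < τ := hτ₀.trans_le hτ.1
            exact (mul_pos hτp (Real.sqrt_pos.2 hτp)).ne'
          rw [ofReal_integral_eq_lintegral_ofReal (hcont.integrableOn_compact isCompact_Icc)]
          refine (ae_restrict_iff' measurableSet_Icc).2 (ae_of_all _ fun τ hτ => ?_)
          have hτp : 0 < τ := hτ₀.trans_le hτ.1
          positivity
    _ ≤ ENNReal.ofReal (τ₀ * (G * V)) +
          ENNReal.ofReal (Real.sqrt (V * ε) * (2 * (Real.sqrt τ₀)⁻¹)) := by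
        gcongr
        rw [integral_Icc_eq_integral_Ioc, ← intervalIntegral.integral_of_le hτ₁,
          intervalIntegral.integral_const_mul]
        exact mul_le_mul_of_nonneg_left (integral_inv_mul_sqrt_le hτ₀ hτ₁) (Real.sqrt_nonneg _)

/-- **Jensen, `L¹` form**: `‖f(x) − ⨍_S f‖ₑ ≤ |S|⁻¹ ∫_S ‖f(x) − f(y)‖ₑ dy` for `f` integrable on a
set `S` of finite positive measure. [folklore] -/
theorem enorm_sub_setAverage_le {f : EuclideanSpace ℝ (Fin 3) → F} {S : Set (EuclideanSpace ℝ (Fin 3))}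
    (hS0 : volume S ≠ 0) (hStop : volume S ≠ ⊤) (hint : IntegrableOn f S volume)
    (x : EuclideanSpace ℝ (Fin 3)) :
    ‖f x - ⨍ y in S, f y‖ₑ ≤ (volume S)⁻¹ * ∫⁻ y in S, ‖f x - f y‖ₑ := by
  have hc : volume.real S = (volume S).toReal := measureReal_def _ _
  have hcpos : 0 < volume.real S := by rw [hc]; exact ENNReal.toReal_pos hS0 hStop
  have hconst : IntegrableOn (fun _ : EuclideanSpace ℝ (Fin 3) => f x) S volume :=
    integrableOn_const hStop
  have hmean : f x - ⨍ y in S, f y = (volume.real S)⁻¹ • ∫ y in S, (f x - f y) := by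
    rw [integral_sub hconst hint, setIntegral_const, setAverage_eq, smul_sub,
      smul_smul, inv_mul_cancel₀ hcpos.ne', one_smul]
  rw [hmean, enorm_smul]
  have hci : ‖(volume.real S)⁻¹‖ₑ = (volume S)⁻¹ := by
    rw [Real.enorm_eq_ofReal (inv_nonneg.2 hcpos.le), ENNReal.ofReal_inv_of_pos hcpos, hc,
      ENNReal.ofReal_toReal hStop]
  rw [hci]
  gcongr
  exact enorm_integral_le_lintegral_enorm _

/-- The elementary inequality behind the constants of `norm_sub_average_le_of_energy`:
with `V = (2R)³·4π/3` and `τ₀ = ρ₀/R`,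
`V⁻¹ · 3R · (τ₀ G V + √(Vε) · 2/√τ₀) ≤ 3Gρ₀ + 2√(ε/ρ₀)` (since `108 ≤ 128π`). [folklore] -/
theorem oscillation_constants_le {R ρ₀ ε G : ℝ} (hR : 0 < R) (hρ₀ : 0 < ρ₀) (hε : 0 ≤ ε) :
    ((2 * R) ^ 3 * (π * 4 / 3))⁻¹ * (3 * R *
      (ρ₀ / R * (G * ((2 * R) ^ 3 * (π * 4 / 3))) +
        Real.sqrt (((2 * R) ^ 3 * (π * 4 / 3)) * ε) * (2 * (Real.sqrt (ρ₀ / R))⁻¹))) ≤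
      3 * G * ρ₀ + 2 * Real.sqrt (ε / ρ₀) := by
  set V : ℝ := (2 * R) ^ 3 * (π * 4 / 3) with hV_def
  have hV0 : 0 < V := by positivity
  have hτ₀ : 0 < ρ₀ / R := div_pos hρ₀ hR
  have hsV : 0 < Real.sqrt V := Real.sqrt_pos.2 hV0
  have hsτ : 0 < Real.sqrt (ρ₀ / R) := Real.sqrt_pos.2 hτ₀
  -- first term: equality
  have h1 : V⁻¹ * (3 * R * (ρ₀ / R * (G * V))) = 3 * G * ρ₀ := by
    field_simp
  -- second term: squared comparison
  have h2 : V⁻¹ * (3 * R * (Real.sqrt (V * ε) * (2 * (Real.sqrt (ρ₀ / R))⁻¹))) ≤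
      2 * Real.sqrt (ε / ρ₀) := by
    have hL : 0 ≤ V⁻¹ * (3 * R * (Real.sqrt (V * ε) * (2 * (Real.sqrt (ρ₀ / R))⁻¹))) := by
      positivity
    have hRhs : 0 ≤ 2 * Real.sqrt (ε / ρ₀) := by positivity
    rw [← pow_le_pow_iff_left₀ hL hRhs two_ne_zero]
    have hsq1 : Real.sqrt (V * ε) ^ 2 = V * ε := Real.sq_sqrt (by positivity)
    have hsq2 : Real.sqrt (ρ₀ / R) ^ 2 = ρ₀ / R := Real.sq_sqrt hτ₀.le
    have hsq3 : Real.sqrt (ε / ρ₀) ^ 2 = ε / ρ₀ := Real.sq_sqrt (by positivity)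
    have hπ := Real.pi_gt_three
    calc (V⁻¹ * (3 * R * (Real.sqrt (V * ε) * (2 * (Real.sqrt (ρ₀ / R))⁻¹)))) ^ 2
        = 36 * R ^ 2 * ε / (V * (ρ₀ / R)) := by
          rw [show (V⁻¹ * (3 * R * (Real.sqrt (V * ε) * (2 * (Real.sqrt (ρ₀ / R))⁻¹)))) ^ 2 =
              V⁻¹ ^ 2 * (9 * R ^ 2) * (Real.sqrt (V * ε) ^ 2 * (4 * (Real.sqrt (ρ₀ / R) ^ 2)⁻¹))
              by ring, hsq1, hsq2]
          field_simp
          ring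
      _ ≤ (2 * Real.sqrt (ε / ρ₀)) ^ 2 := by
          rw [mul_pow, hsq3, hV_def]
          rw [div_le_iff₀ (by positivity)]
          field_simp
          nlinarith [mul_nonneg hε (sub_nonneg.2 hπ.le)]
  calc V⁻¹ * (3 * R * (ρ₀ / R * (G * V) + Real.sqrt (V * ε) * (2 * (Real.sqrt (ρ₀ / R))⁻¹)))
      = V⁻¹ * (3 * R * (ρ₀ / R * (G * V))) +
          V⁻¹ * (3 * R * (Real.sqrt (V * ε) * (2 * (Real.sqrt (ρ₀ / R))⁻¹))) := by ring
    _ ≤ 3 * G * ρ₀ + 2 * Real.sqrt (ε / ρ₀) := by rw [h1]; gcongr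

/-- **Oscillation of a `C¹` map with bounded gradient and small energy on a ball.** Let
`f ∈ C¹(ℝ³; F)` with `‖Df‖ ≤ G` everywhere and `∫_{B(x₀,2R)} ‖Df‖² ≤ ε`. Then for every
`x ∈ B(x₀, R)` and every `0 < ρ₀ ≤ R`: `‖f(x) − ⨍_{B(x₀,2R)} f‖ ≤ 3Gρ₀ + 2√(ε/ρ₀)` — a bound
independent of `R` (module docstring for the proof). [folklore] -/
theorem norm_sub_average_le_of_energy {f : EuclideanSpace ℝ (Fin 3) → F} (hf : ContDiff ℝ 1 f)
    {G ε ρ₀ R : ℝ} (hG0 : 0 ≤ G) (hG : ∀ z, ‖fderiv ℝ f z‖ ≤ G) (hε : 0 ≤ ε) (hρ₀ : 0 < ρ₀)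
    (hρR : ρ₀ ≤ R) {x₀ : EuclideanSpace ℝ (Fin 3)}
    (hD : ∫⁻ z in ball x₀ (2 * R), ‖fderiv ℝ f z‖ₑ ^ 2 ≤ ENNReal.ofReal ε)
    {x : EuclideanSpace ℝ (Fin 3)} (hx : x ∈ ball x₀ R) :
    ‖f x - ⨍ y in ball x₀ (2 * R), f y‖ ≤ 3 * G * ρ₀ + 2 * Real.sqrt (ε / ρ₀) := by
  have hR : 0 < R := hρ₀.trans_le hρR
  set V : ℝ := (2 * R) ^ 3 * (π * 4 / 3) with hV_def
  have hV0 : 0 < V := by positivity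
  have hvol : volume (ball x₀ (2 * R)) = ENNReal.ofReal V := by
    rw [EuclideanSpace.volume_ball_fin_three, hV_def, ← ENNReal.ofReal_pow (by positivity),
      ← ENNReal.ofReal_mul (by positivity)]
  set τ₀ : ℝ := ρ₀ / R with hτ₀_def
  have hτ₀ : 0 < τ₀ := div_pos hρ₀ hR
  have hτ₁ : τ₀ ≤ 1 := (div_le_one hR).2 hρR
  -- Jensen
  have hint : IntegrableOn f (ball x₀ (2 * R)) volume :=
    (hf.continuous.continuousOn.integrableOn_compact (isCompact_closedBall x₀ (2 * R))).mono_set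
      ball_subset_closedBall
  have hS0 : volume (ball x₀ (2 * R)) ≠ 0 := by
    rw [hvol]; exact (ENNReal.ofReal_pos.2 hV0).ne'
  have hStop : volume (ball x₀ (2 * R)) ≠ ⊤ := by rw [hvol]; exact ENNReal.ofReal_ne_top
  have hJensen := enorm_sub_setAverage_le hS0 hStop hint x
  -- the segment bound, pointwise in `y`
  have hseg : ∀ y ∈ ball x₀ (2 * R), ‖f x - f y‖ₑ ≤ ENNReal.ofReal (3 * R) *
      ∫⁻ τ in Icc (0 : ℝ) 1, ‖fderiv ℝ f (x + τ • (y - x))‖ₑ := by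
    intro y hy
    rw [enorm_sub_rev]
    refine (enorm_sub_le_mul_lintegral_segment hf x y).trans ?_
    gcongr
    rw [← ofReal_norm]
    refine ENNReal.ofReal_le_ofReal ?_
    have h1 : ‖y - x₀‖ < 2 * R := mem_ball_iff_norm.1 hy
    have h2 : ‖x - x₀‖ < R := mem_ball_iff_norm.1 hx
    calc ‖y - x‖ = ‖(y - x₀) - (x - x₀)‖ := by congr 1; abel
      _ ≤ ‖y - x₀‖ + ‖x - x₀‖ := norm_sub_le _ _
      _ ≤ 3 * R := by linarith
  -- Tonelli
  have hmeas : Measurable (uncurry fun (y : EuclideanSpace ℝ (Fin 3)) (τ : ℝ) =>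
      ‖fderiv ℝ f (x + τ • (y - x))‖ₑ) := by
    have hc : Continuous fun p : EuclideanSpace ℝ (Fin 3) × ℝ =>
        fderiv ℝ f (x + p.2 • (p.1 - x)) :=
      (hf.continuous_fderiv one_ne_zero).comp (by fun_prop)
    exact hc.measurable.enorm
  have hTonelli : ∫⁻ y in ball x₀ (2 * R), ∫⁻ τ in Icc (0 : ℝ) 1, ‖fderiv ℝ f (x + τ • (y - x))‖ₑ =
      ∫⁻ τ in Icc (0 : ℝ) 1, ∫⁻ y in ball x₀ (2 * R), ‖fderiv ℝ f (x + τ • (y - x))‖ₑ :=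
    lintegral_lintegral_swap hmeas.aemeasurable
  -- assemble in `ℝ≥0∞`
  have hmain : ‖f x - ⨍ y in ball x₀ (2 * R), f y‖ₑ ≤
      ENNReal.ofReal (V⁻¹ * (3 * R * (τ₀ * (G * V) +
        Real.sqrt (V * ε) * (2 * (Real.sqrt τ₀)⁻¹)))) := by
    calc ‖f x - ⨍ y in ball x₀ (2 * R), f y‖ₑ
        ≤ (volume (ball x₀ (2 * R)))⁻¹ * ∫⁻ y in ball x₀ (2 * R), ‖f x - f y‖ₑ := hJensen
      _ ≤ (volume (ball x₀ (2 * R)))⁻¹ * ∫⁻ y in ball x₀ (2 * R), ENNReal.ofReal (3 * R) *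
            ∫⁻ τ in Icc (0 : ℝ) 1, ‖fderiv ℝ f (x + τ • (y - x))‖ₑ := by
          exact mul_le_mul' le_rfl (setLIntegral_mono' measurableSet_ball hseg)
      _ = (ENNReal.ofReal V)⁻¹ * (ENNReal.ofReal (3 * R) *
            ∫⁻ τ in Icc (0 : ℝ) 1, ∫⁻ y in ball x₀ (2 * R), ‖fderiv ℝ f (x + τ • (y - x))‖ₑ) := by
          rw [hvol, lintegral_const_mul' _ _ ENNReal.ofReal_ne_top, hTonelli]
      _ ≤ (ENNReal.ofReal V)⁻¹ * (ENNReal.ofReal (3 * R) *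
            (ENNReal.ofReal (τ₀ * (G * V)) +
              ENNReal.ofReal (Real.sqrt (V * ε) * (2 * (Real.sqrt τ₀)⁻¹)))) := by
          gcongr
          exact lintegral_lintegral_fderiv_segment_le (f := f) hR hx hε hG0 hG hD hτ₀ hτ₁
      _ = ENNReal.ofReal (V⁻¹ * (3 * R * (τ₀ * (G * V) +
            Real.sqrt (V * ε) * (2 * (Real.sqrt τ₀)⁻¹)))) := by
          rw [← ENNReal.ofReal_add (by positivity) (by positivity),
            ← ENNReal.ofReal_mul (by positivity), ← ENNReal.ofReal_inv_of_pos hV0,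
            ← ENNReal.ofReal_mul (by positivity)]
  -- back to real numbers
  have hfin : ‖f x - ⨍ y in ball x₀ (2 * R), f y‖ ≤ V⁻¹ * (3 * R * (τ₀ * (G * V) +
      Real.sqrt (V * ε) * (2 * (Real.sqrt τ₀)⁻¹))) := by
    rw [← ENNReal.ofReal_le_ofReal_iff (by positivity), ofReal_norm]
    exact hmain
  exact hfin.trans (oscillation_constants_le hR hρ₀ hε)

end Summit.NavierStokesRegularity.NavierStokesRegularity.Theorems.PlaneEnergyCeilingPlanarEnergyLiouville

end
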